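import Literature.NumberTheory.EllipticCurves.Kato2004.IwasawaH1LayerTorsionBoundProofs
import HarnessLib

/-!
# The torsion of `H¹(U, T_pE)` injects into the `U`-fixed points of `E[p^k]`: `#H¹(U, T_pE)[p^k] ≤ #E[p^k]^U`,
# hence `#H¹(ℚ, T_pE)[p^k] ≤ #E(ℚ)[p^k]` (Kato's `A_tors ⊆ H¹(ℚ,T)_tors ↞ E(ℚ)[p^∞]`, the `t₀` of crux M's ledger)
# (route `KatoDescentPotSupersingular` / `…Tame…`, crux M = stmt-BirchSwinnertonDyer-19196; route-free helper)

Seat `bsd-potss-rkm` g20 (prover; cell `bsd-potss`), item stmt-BirchSwinnertonDyer-19196 (`--supports … --as helper`; closes nothing).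
HONEST FRAMING: BSD is not proved by any of this; nothing is booked; theorems only (no definition, no named fact).

## What

For an elliptic curve `W/ℚ`, a prime `p`, any subgroup `U ≤ Γ_ℚ` and any `k`, the Bockstein of the exact sequence
`0 → T_pW →(p^k) T_pW → W[p^k] → 0` gives `W[p^k]^U ↠ H¹(U, T_pW)[p^k]`; we prove the resulting count on cochains
(same mechanism as `IwasawaH1LayerNorm.exists_forall_pow_smul_eq_zero_of_pow_smul_eq_zero`, rkm g7): if `p^k [φ] = 0`
then `p^k φ = ∂m`, `m mod p^k ∈ W[p^k]^U`, and `[φ] ↦ m mod p^k` is injective (`m ≡ m' mod p^k T_pW` forces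
`φ − φ' = ∂b` after cancelling `p^k` in the torsion-free `T_pW`).

* `exists_bockstein_of_pow_smul_eq_zero` — the witness `m` with `p^k φ(g) = g m − m` and `m mod p^k` fixed by `U`;
* **`natCard_torsionBy_H1_le_natCard_fixed`** — `#H¹(U, T_pW)[p^k] ≤ #{w ∈ W[p^k] | U w = w}`, and `finite_torsionBy_H1`;
* `natCard_fixed_geomTorsion_eq_natCard_torsionBy_point` — `#{w ∈ W[n] | Γ_ℚ w = w} = #E(ℚ)[n]` (Galois descent for points,
  tree `fixedPoints_eq_range_map_holds`);
* **`natCard_torsionBy_H1_top_le_natCard_torsionBy_point`** — `#H¹(ℚ, T_pW)[p^k] ≤ #E(ℚ)[p^k]`, and for any subgroup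
  `A ≤ H¹(ℚ, T_pW)` (Kato's `A = H¹(ℤ[1/p], T_pW)`): `#(A ⊓ H¹(ℚ,T_pW)[p^k]) ≤ #E(ℚ)[p^k]`, `Finite` versions.

This is the factor `#A[p^N] ≤ p^{t₀}` of the A-side junction (part 47) in crux M's level-0 ledger (Kato p. 244: `H¹(ℤ[1/p],T)_tors = E(ℚ)[p^∞]`
in rank `0`).

References: K. Kato, Astérisque 295 (2004), §13.8 (p. 228), proof of Prop. 14.16 (2) (p. 244) [Kato2004Asterisque]; K. Rubin, *Euler Systems*
(2000), App. B §2–§3 [Rubin2000]; J. H. Silverman, *AEC* (2009), III §7, VIII §1 [SilvermanAEC2009].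
-/

-- the summit and its single problem are both named `BirchSwinnertonDyer` (registry layout D-0017)
set_option linter.dupNamespace false
set_option autoImplicit false

noncomputable section

open scoped NumberField AddSubgroup Classical
open Field CategoryTheory
open Literature.NumberTheory.GaloisRepresentations
open Literature.NumberTheory.EllipticCurves Literature.NumberTheory.EllipticCurves.Kato2004
open Literature.NumberTheory.EllipticCurves.Kato2004.EulerSystemValues
open Literature.NumberTheory.EllipticCurves.Kato2004.IwasawaH1LayerNorm
open WeierstrassCurve (geomPoints geomTorsion)

namespace Summit.BirchSwinnertonDyer.BirchSwinnertonDyer.Theorems.H1TateTorsion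

section Bockstein

variable {p : ℕ} [hp : Fact p.Prime] (W : WeierstrassCurve ℚ) [W.IsElliptic] [ContinuousSMul ℤ_[p] (W.tateModule p)]
  (U : Subgroup (absoluteGaloisGroup ℚ))

/-- **Bockstein witness.** If `p^k • [φ] = 0` in `H¹(U, T_pW)` then there is `m ∈ T_pW` with `p^k φ(g) = g m − m` for all
`g ∈ U`, and `m mod p^k ∈ W[p^k]` is fixed by `U`. [cite: Kato2004Asterisque, §13.8 (p. 228)] [cite: Rubin2000, App. B §2] -/
theorem exists_bockstein_of_pow_smul_eq_zero (k : ℕ) (φ : contOneCocycles (subgroupRep (tateRep W p).toTopRep U))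
    (hφ : ((p : ℤ_[p]) ^ k) • oneCocycleClass _ φ = 0) :
    ∃ m : W.tateModule p,
      (∀ g : U, p ^ k • (φ.1 g : W.tateModule p) = (g : absoluteGaloisGroup ℚ) • m - m) ∧
      ∀ g ∈ U, g • tateModPk W p k m = tateModPk W p k m := by
  have hρ : ∀ (g : U) (a : W.tateModule p),
      (subgroupRep (tateRep W p).toTopRep U).ρ g a = (g : absoluteGaloisGroup ℚ) • a := fun g a => rfl
  rw [← oneCocycleClass_smul, oneCocycleClass_eq_zero_iff] at hφ
  obtain ⟨m, hm⟩ := hφ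
  have hm' : ∀ g : U, p ^ k • (φ.1 g : W.tateModule p) = (g : absoluteGaloisGroup ℚ) • m - m := fun g => by
    have h := hm g
    rw [Submodule.coe_smul, ContinuousMap.smul_apply, ← Nat.cast_pow, Nat.cast_smul_eq_nsmul, hρ] at h
    exact h
  refine ⟨m, hm', fun g hg => ?_⟩
  have hgm : g • m = p ^ k • (φ.1 ⟨g, hg⟩ : W.tateModule p) + m := sub_eq_iff_eq_add.mp (hm' ⟨g, hg⟩).symm
  rw [← tateModPk_smul]
  apply Subtype.ext
  rw [coe_tateModPk_apply, coe_tateModPk_apply, hgm, map_add, map_nsmul, TateModule.pow_smul_proj, zero_add]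

/-- **`#H¹(U, T_pW)[p^k] ≤ #W[p^k]^U` and `H¹(U, T_pW)[p^k]` is finite**: `[φ] ↦ m mod p^k` (a Bockstein witness `m`) is
injective — if `m ≡ m' (mod p^k T_pW)`, `m − m' = p^k b`, then `p^k(φ − φ') = ∂(p^k b)` and, `T_pW` being torsion-free,
`φ − φ' = ∂b`. [cite: Kato2004Asterisque, §13.8 (p. 228) and proof of Prop. 14.16 (2) (p. 244)] [cite: Rubin2000, App. B §2–§3] -/
theorem natCard_torsionBy_H1_le_natCard_fixed (k : ℕ) :
    Nat.card ↥((H1 (tateRep W p) U)[((p ^ k : ℕ) : ℤ)]) ≤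
        Nat.card {w : geomTorsion W ((p : ℤ) ^ k) // ∀ g ∈ U, g • w = w} ∧
      Finite ↥((H1 (tateRep W p) U)[((p ^ k : ℕ) : ℤ)]) := by
  classical
  haveI : Finite (geomTorsion W ((p : ℤ) ^ k)) :=
    W.finite_torsionPoints_holds (AlgebraicClosure ℚ) (pow_ne_zero k (Int.natCast_ne_zero.mpr hp.out.ne_zero))
  set X := subgroupRep (tateRep W p).toTopRep U
  have hρ : ∀ (g : U) (a : W.tateModule p), X.ρ g a = (g : absoluteGaloisGroup ℚ) • a := fun g a => rfl
  -- representatives and Bockstein witnesses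
  choose φ hφ using oneCocycleClass_surjective X
  have htor : ∀ y : ↥((H1 (tateRep W p) U)[((p ^ k : ℕ) : ℤ)]),
      ((p : ℤ_[p]) ^ k) • oneCocycleClass X (φ (y : H1 (tateRep W p) U)) = 0 := fun y => by
    have hy : ((p ^ k : ℕ) : ℤ) • (y : H1 (tateRep W p) U) = 0 :=
      (Submodule.mem_torsionBy_iff _ _).mp y.2
    rw [hφ, ← Nat.cast_pow, Nat.cast_smul_eq_nsmul]
    rwa [Nat.cast_smul_eq_nsmul] at hy
  choose m hm hfix using fun y : ↥((H1 (tateRep W p) U)[((p ^ k : ℕ) : ℤ)]) =>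
    exists_bockstein_of_pow_smul_eq_zero W U k (φ (y : H1 (tateRep W p) U)) (htor y)
  let θ : ↥((H1 (tateRep W p) U)[((p ^ k : ℕ) : ℤ)]) → {w : geomTorsion W ((p : ℤ) ^ k) // ∀ g ∈ U, g • w = w} :=
    fun y => ⟨tateModPk W p k (m y), hfix y⟩
  have hθ : Function.Injective θ := by
    intro y₁ y₂ h
    have h1 : TateModule.proj p k (m y₁ - m y₂) = 0 := by
      have h' := congrArg (fun w : {w : geomTorsion W ((p : ℤ) ^ k) // ∀ g ∈ U, g • w = w} =>
        ((w.1 : geomTorsion W ((p : ℤ) ^ k)) : geomPoints W)) h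
      simp only [θ, coe_tateModPk_apply] at h'
      rw [map_sub, h', sub_self]
    obtain ⟨b, hb⟩ := exists_pow_smul_eq_of_proj_eq_zero W k _ h1
    -- `φ₁ − φ₂ = ∂b`
    have hcoc : ∀ g : U, ((φ (y₁ : H1 (tateRep W p) U) - φ (y₂ : H1 (tateRep W p) U)).1 g : W.tateModule p) =
        (g : absoluteGaloisGroup ℚ) • b - b := fun g => by
      apply eq_of_pow_smul_eq W k
      have hg₁ := hm y₁ g
      have hg₂ := hm y₂ g
      have hgb : (g : absoluteGaloisGroup ℚ) • (p ^ k • b) = p ^ k • ((g : absoluteGaloisGroup ℚ) • b) := smul_comm _ _ _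
      calc p ^ k • (((φ (y₁ : H1 (tateRep W p) U) - φ (y₂ : H1 (tateRep W p) U)).1 g : W.tateModule p))
          = p ^ k • (φ (y₁ : H1 (tateRep W p) U)).1 g - p ^ k • (φ (y₂ : H1 (tateRep W p) U)).1 g := by
            rw [Submodule.coe_sub, ContinuousMap.sub_apply, nsmul_sub]
        _ = (g : absoluteGaloisGroup ℚ) • (m y₁ - m y₂) - (m y₁ - m y₂) := by rw [hg₁, hg₂, smul_sub]; abel
        _ = p ^ k • ((g : absoluteGaloisGroup ℚ) • b - b) := by rw [← hb, hgb, nsmul_sub]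
    have h0 : oneCocycleClass X (φ (y₁ : H1 (tateRep W p) U) - φ (y₂ : H1 (tateRep W p) U)) = 0 := by
      rw [oneCocycleClass_eq_zero_iff]
      exact ⟨b, fun g => by rw [hρ]; exact hcoc g⟩
    rw [oneCocycleClass_sub, hφ, hφ, sub_eq_zero] at h0
    exact Subtype.ext h0
  exact ⟨Nat.card_le_card_of_injective θ hθ, Finite.of_injective θ hθ⟩

/-- `H¹(U, T_pW)[p^k]` is finite. [cite: Kato2004Asterisque, §13.8 (p. 228)] [cite: Rubin2000, App. B §2–§3] -/
theorem finite_torsionBy_H1 (k : ℕ) : Finite ↥((H1 (tateRep W p) U)[((p ^ k : ℕ) : ℤ)]) :=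
  (natCard_torsionBy_H1_le_natCard_fixed W U k).2

end Bockstein

section Descent

variable (W : WeierstrassCurve ℚ)

/-- **`#{w ∈ W[n] | Γ_ℚ w = w} = #E(ℚ)[n]`**: Galois descent for points (`E(ℚ̄)^{Γ_ℚ} = E(ℚ)`, tree
`fixedPoints_eq_range_map_holds`) restricted to the `n`-torsion; the base change `E(ℚ) → E(ℚ̄)` is injective.
[cite: SilvermanAEC2009, VIII.§1 (proof of Prop. 1.2) and III.§7] -/
theorem natCard_fixed_geomTorsion_eq_natCard_torsionBy_point (n : ℤ) :
    Nat.card {w : geomTorsion W n // ∀ g ∈ (⊤ : Subgroup (absoluteGaloisGroup ℚ)), g • w = w} =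
      Nat.card ↥(W.toAffine.Point[n]) := by
  let β : W.toAffine.Point →+ geomPoints W :=
    WeierstrassCurve.Affine.Point.baseChange (W' := W.toAffine) ℚ (AlgebraicClosure ℚ)
  have hβ : Function.Injective β := WeierstrassCurve.Affine.Point.map_injective _
  have hβfix : ∀ (σ : absoluteGaloisGroup ℚ) (P : W.toAffine.Point), σ • β P = β P := by
    intro σ P
    have hP : β P ∈ MulAction.fixedPoints (absoluteGaloisGroup ℚ) (geomPoints W) := by
      rw [W.fixedPoints_eq_range_map_holds]
      exact ⟨P, rfl⟩
    exact hP σ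
  symm
  refine Nat.card_congr (Equiv.ofBijective
    (fun P => ⟨⟨β P.1, ?_⟩, fun g _ => Subtype.ext ?_⟩) ⟨fun P Q h => ?_, fun w => ?_⟩)
  · show β P.1 ∈ (Submodule.torsionBy ℤ (geomPoints W) n).toAddSubgroup
    rw [Submodule.mem_toAddSubgroup, Submodule.mem_torsionBy_iff, ← map_zsmul,
      (Submodule.mem_torsionBy_iff _ _).mp P.2, map_zero]
  · rw [AddSubgroup.torsionBy.coe_smul]
    exact hβfix g P.1
  · have h' := congrArg (fun x : {w : geomTorsion W n // ∀ g ∈ (⊤ : Subgroup (absoluteGaloisGroup ℚ)), g • w = w} =>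
      ((x.1 : geomTorsion W n) : geomPoints W)) h
    exact Subtype.ext (hβ h')
  · have hfix : ((w.1 : geomTorsion W n) : geomPoints W) ∈
        MulAction.fixedPoints (absoluteGaloisGroup ℚ) (geomPoints W) := fun g => by
      have h := congrArg Subtype.val (w.2 g (Subgroup.mem_top g))
      rwa [AddSubgroup.torsionBy.coe_smul] at h
    rw [W.fixedPoints_eq_range_map_holds] at hfix
    obtain ⟨P₀, hP₀⟩ := hfix
    let P : W.toAffine.Point := P₀
    have hP : β P = ((w.1 : geomTorsion W n) : geomPoints W) := hP₀
    have hPn : P ∈ W.toAffine.Point[n] := by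
      refine (Submodule.mem_torsionBy_iff _ _).mpr (hβ ?_)
      rw [map_zsmul, map_zero, hP]
      exact (Submodule.mem_torsionBy_iff _ _).mp w.1.2
    exact ⟨⟨P, hPn⟩, Subtype.ext (Subtype.ext hP)⟩

end Descent

section Rational

variable {p : ℕ} [hp : Fact p.Prime] (W : WeierstrassCurve ℚ) [W.IsElliptic] [ContinuousSMul ℤ_[p] (W.tateModule p)]

/-- **`#H¹(ℚ, T_pW)[p^k] ≤ #E(ℚ)[p^k]`** (`H¹(ℚ, T_pW) = H1 (tateRep W p) ⊤`): part `≤ #W[p^k]^{Γ_ℚ}` and Galois descent.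
[cite: Kato2004Asterisque, proof of Prop. 14.16 (2) (p. 244: `H¹(ℤ[1/p],T)_tors = H⁰(ℚ, T ⊗ ℚ/ℤ)`)] [cite: SilvermanAEC2009, VIII.§1] -/
theorem natCard_torsionBy_H1_top_le_natCard_torsionBy_point (k : ℕ) :
    Nat.card ↥((H1 (tateRep W p) ⊤)[((p ^ k : ℕ) : ℤ)]) ≤ Nat.card ↥(W.toAffine.Point[((p ^ k : ℕ) : ℤ)]) := by
  have h := (natCard_torsionBy_H1_le_natCard_fixed W (p := p) ⊤ k).1
  rw [natCard_fixed_geomTorsion_eq_natCard_torsionBy_point W ((p : ℤ) ^ k)] at h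
  rwa [Nat.cast_pow]

/-- **`#(A ⊓ H¹(ℚ, T_pW)[p^k]) ≤ #E(ℚ)[p^k]`** for every subgroup `A ≤ H¹(ℚ, T_pW)` — the factor `#A[p^N] ≤ #E(ℚ)[p^N] ≤ p^{t₀}` of
the A-side junction for Kato's `A = H¹(ℤ[1/p], T_pW)`. [cite: Kato2004Asterisque, proof of Prop. 14.16 (2) (p. 244)] [cite: SilvermanAEC2009, VIII.§1] -/
theorem natCard_inf_torsionBy_le_natCard_torsionBy_point (A : AddSubgroup (H1 (tateRep W p) ⊤)) (k : ℕ) :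
    Nat.card ↥(A ⊓ (H1 (tateRep W p) ⊤)[((p ^ k : ℕ) : ℤ)]) ≤ Nat.card ↥(W.toAffine.Point[((p ^ k : ℕ) : ℤ)]) := by
  haveI := finite_torsionBy_H1 W (p := p) ⊤ k
  exact (AddSubgroup.card_le_of_le inf_le_right).trans (natCard_torsionBy_H1_top_le_natCard_torsionBy_point W k)

/-- `A ⊓ H¹(ℚ, T_pW)[p^k]` is finite for every subgroup `A ≤ H¹(ℚ, T_pW)`. [cite: Kato2004Asterisque, proof of Prop. 14.16 (2) (p. 244)] -/
theorem finite_inf_torsionBy (A : AddSubgroup (H1 (tateRep W p) ⊤)) (k : ℕ) :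
    Finite ↥(A ⊓ (H1 (tateRep W p) ⊤)[((p ^ k : ℕ) : ℤ)]) := by
  haveI := finite_torsionBy_H1 W (p := p) ⊤ k
  exact Finite.of_injective _ (AddSubgroup.inclusion_injective (inf_le_right (a := A)))

end Rational

end Summit.BirchSwinnertonDyer.BirchSwinnertonDyer.Theorems.H1TateTorsion

end
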